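import Mathlib
import Summits.Ventures.HodgeRepro.Tier4.Line4.SuppMeasure
import Summits.Ventures.HodgeRepro.Tier4.Line4.CentreFinDomain
import Summits.Ventures.HodgeRepro.Tier4.Line4.CentralCover

/-!
# Tier4/Line4/UnitLowerBound — C-L4-UNIT-LOWER (F-d) instantiated: the unit `suppMeasure N γ₀` is at least the number of
`Z_f`-translates of the level box inside `DZ_f` times the box's measure

Blind re-derivation cell `pub-hodge-repro`, Tier 4 «prove the step» (README §9–§10), seat t4-L1-p4 (gen 5; LINE L4;
STATUS S15701 NEXT, the (F-d) instance of S15641 (3)).  Tree path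
`lean/Summits/Ventures/HodgeRepro/Tier4/Line4/UnitLowerBound.lean`.  Imports `Line4/SuppMeasure` (t4-L2-p1, p704106:
`suppSet`, `suppMeasure`, `levelTf_prod_subset_suppSet`; through it `Line4/LevelVolume`: `levelTf`, `levelTf′`,
`measurableSet_levelTf(′)`), `Line4/CentreFinDomain` (t4-L2-p2, p696615: `ZfIn`), `Line4/CentralCover` (this seat,
p710462: `measure_smul_set_eq`).  Mathlib-level; no literature; no `def`.

WHAT.  The display (F) compares the compact-cut measure at `γ` (CompactCutFold p710409, then (F-c) CentralCover p710462
at `T_p` through P1/P2/P3) with the UNIT `suppMeasure N γ₀ = (ν_f ⊗ ν′_f)(suppSet γ₀ ∩ (DZ_f × T′_f))`.  The unit's lower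
bound in the same currency: the support set at `γ₀` contains the level box `levelTf N × levelTf′ N` and is invariant
under the diagonal finite centre (a central `z` cancels in `c⁻¹ γ₀,f c′`), so for every finite set `J ⊆ Z_f` of
representatives of DISTINCT cosets of `T_f ∩ K(N)` whose translates `j · levelTf N` lie in `DZ_f`, the boxes
`(j · levelTf N) × (ζ_j · levelTf′ N)` (`ζ_j ∈ T′_f` the same central element) are pairwise disjoint, inside
`suppSet γ₀ ∩ (DZ_f × T′_f)`, each of measure `ν_f(levelTf N) · ν′_f(levelTf′ N)`:
* `exists_torusFin'_coe_eq`, `coe_mem_centre_of_mem_ZfIn`, `exists_diag_of_mem_ZfIn` — the diagonal partner `ζ ∈ T′_f` of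
  `z ∈ Z_f ∩ T_f` (the same element of `G(𝔸)`, central);
* `suppSet_diag_mul_mem_iff_of_mem_ZfIn` — `(z c, ζ c′) ∈ suppSet γ₀ N γ ↔ (c, c′) ∈ suppSet γ₀ N γ` for `z ∈ Z_f`;
* `smul_levelTf_prod_subset_suppSet` — `(z · levelTf N) × (ζ · levelTf′ N) ⊆ suppSet γ₀ N γ₀`;
* `disjoint_smul_levelTf_of_inv_mul_notMem` — `j⁻¹ j′ ∉ levelTf N ⇒ (j · levelTf N) ∩ (j′ · levelTf N) = ∅`;
* **`card_mul_measure_levelBox_le_suppMeasure` (F-d, instantiated)** —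
  `|J| · ν_f(levelTf N) · ν′_f(levelTf′ N) ≤ suppMeasure N γ₀` for `J ⊆ Z_f` as above.
WHAT IS LEFT for the unit: the CHOICE of `J` with `|J| = [Z_f ∩ B₀ : Z_f ∩ levelTf N]` for a compact open subgroup
`B₀ ⊆ DZ_f` containing `levelTf N` (ZDOMAIN-EX's neighbourhood of `1` in `DZ_f`, or the `hDZ : levelTf (p^{n₁}) ⊆ DZ_f`
choice of record), and the comparison of that index with (F-c)'s `[Z_p ∩ B(n₀) : Z_p ∩ B(n)]` (P3's bounded ratio) —
elementary group theory, not typed here.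

Nothing here says anything about the status of the Hodge conjecture for CM abelian varieties, which is NOT proved
(HC_CM is NOT proved by anyone in this repository).
-/

set_option autoImplicit false
noncomputable section
namespace Summit.Ventures.HodgeRepro.Tier4.Line4
open Summit.Ventures.HodgeRepro.Tier4 Summit.Ventures.HodgeRepro.Tier4.Common
  Summit.Ventures.HodgeRepro.Tier4.Line1 MeasureTheory
open scoped ENNReal Pointwise

section Diag
variable {k : Type} [Field k] [NumberField k] (W : PlaneData k)

/-- An element of `G(𝔸)` in `T′` and in the finite part is the underlying element of a point of `T′_f`. -/
theorem exists_torusFin'_coe_eq (g : GA W) (h1 : g ∈ torusT' W) (h2 : g ∈ finitePart W) :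
    ∃ ζ : torusFin' W, ((ζ : torusT' W) : GA W) = g :=
  ⟨⟨⟨g, h1⟩, Subgroup.mem_subgroupOf.2 h2⟩, rfl⟩

/-- The underlying element of a point of `Z_f ≤ T_f` (`ZfIn W`) is in the centre `Z`. -/
theorem coe_mem_centre_of_mem_ZfIn {z : torusFin W} (hz : z ∈ ZfIn W) :
    ((z : torusT W) : GA W) ∈ centre W := by
  unfold ZfIn at hz
  rw [Subgroup.mem_subgroupOf, Subgroup.mem_subgroupOf] at hz
  exact hz

/-- **The diagonal partner of a central element of `T_f`**: for `z ∈ Z_f` (as `ZfIn W ≤ T_f`) there is `ζ ∈ T′_f` which is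
the same element of `G(𝔸)`, and that element is central in `G(𝔸)`. -/
theorem exists_diag_of_mem_ZfIn {z : torusFin W} (hz : z ∈ ZfIn W) :
    ∃ ζ : torusFin' W, ((ζ : torusT' W) : GA W) = ((z : torusT W) : GA W) ∧
      ((z : torusT W) : GA W) ∈ Subgroup.center (GA W) := by
  have hzc : ((z : torusT W) : GA W) ∈ centre W := coe_mem_centre_of_mem_ZfIn W hz
  obtain ⟨ζ, hζ⟩ := exists_torusFin'_coe_eq W _ (centre_le_torusT' W hzc) (coe_coe_mem_finitePart W z)
  exact ⟨ζ, hζ, centre_le_center W hzc⟩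

/-- A central element of `G(𝔸)` lying in `T_f` (as `z`) and in `T′_f` (as `ζ`, the same element) cancels in the
support condition: `(z c, ζ c′) ∈ suppSet γ₀ N γ ↔ (c, c′) ∈ suppSet γ₀ N γ`. -/
theorem suppSet_diag_mul_mem_iff_of_mem_ZfIn (γ₀ : GA W) (N : ℕ) (γ : GA W) {z : torusFin W} {ζ : torusFin' W}
    (hzζ : ((ζ : torusT' W) : GA W) = ((z : torusT W) : GA W))
    (hz : ((z : torusT W) : GA W) ∈ Subgroup.center (GA W)) (p : torusFin W × torusFin' W) :
    (z * p.1, ζ * p.2) ∈ suppSet W γ₀ N γ ↔ p ∈ suppSet W γ₀ N γ := by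
  simp only [suppSet, Set.mem_setOf_eq, Subgroup.coe_mul, mul_inv_rev, hzζ]
  have hC : ∀ g : GA W, Commute g ((z : torusT W) : GA W) := fun g => Subgroup.mem_center_iff.1 hz g
  have h : (((p.1 : torusT W) : GA W))⁻¹ * (((z : torusT W) : GA W))⁻¹ * GA.ofFinPart W γ *
      (((z : torusT W) : GA W) * ((p.2 : torusT' W) : GA W)) =
      (((p.1 : torusT W) : GA W))⁻¹ * GA.ofFinPart W γ * ((p.2 : torusT' W) : GA W) := by
    calc (((p.1 : torusT W) : GA W))⁻¹ * (((z : torusT W) : GA W))⁻¹ * GA.ofFinPart W γ *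
          (((z : torusT W) : GA W) * ((p.2 : torusT' W) : GA W))
        = (((p.1 : torusT W) : GA W))⁻¹ * ((((z : torusT W) : GA W))⁻¹ * (GA.ofFinPart W γ *
            ((z : torusT W) : GA W))) * ((p.2 : torusT' W) : GA W) := by
          simp only [mul_assoc]
      _ = (((p.1 : torusT W) : GA W))⁻¹ * ((((z : torusT W) : GA W))⁻¹ * (((z : torusT W) : GA W) *
            GA.ofFinPart W γ)) * ((p.2 : torusT' W) : GA W) := by
          rw [(hC (GA.ofFinPart W γ)).eq]
      _ = _ := by rw [inv_mul_cancel_left]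
  rw [h]

/-- **A `Z_f`-translate of the level box lies in the support set at `γ₀`**. -/
theorem smul_levelTf_prod_subset_suppSet (γ₀ : GA W) (N : ℕ) {z : torusFin W} {ζ : torusFin' W}
    (hzζ : ((ζ : torusT' W) : GA W) = ((z : torusT W) : GA W))
    (hz : ((z : torusT W) : GA W) ∈ Subgroup.center (GA W)) :
    (z • levelTf W N) ×ˢ (ζ • levelTf' W N) ⊆ suppSet W γ₀ N γ₀ := by
  rintro ⟨c, c'⟩ ⟨⟨l, hl, rfl⟩, ⟨l', hl', rfl⟩⟩
  exact (suppSet_diag_mul_mem_iff_of_mem_ZfIn W γ₀ N γ₀ hzζ hz (l, l')).2 (levelTf_prod_subset_suppSet W γ₀ N ⟨hl, hl'⟩)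

/-- `levelTf N` is closed under `j⁻¹ * j′`-type products: `l ∈ levelTf N`, `l′ ∈ levelTf N ⇒ l * l′⁻¹ ∈ levelTf N`. -/
theorem mul_inv_mem_levelTf (N : ℕ) {l l' : torusFin W} (hl : l ∈ levelTf W N) (hl' : l' ∈ levelTf W N) :
    l * l'⁻¹ ∈ levelTf W N := by
  show (((l * l'⁻¹ : torusFin W) : torusT W) : GA W) ∈ levelK W N
  simp only [Subgroup.coe_mul, Subgroup.coe_inv]
  exact (levelK W N).mul_mem hl ((levelK W N).inv_mem hl')

/-- Two translates of the level box by `j`, `j′` with `j⁻¹ j′ ∉ levelTf N` are disjoint. -/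
theorem disjoint_smul_levelTf_of_inv_mul_notMem (N : ℕ) {j j' : torusFin W} (h : j⁻¹ * j' ∉ levelTf W N) :
    Disjoint (j • levelTf W N) (j' • levelTf W N) := by
  rw [Set.disjoint_left]
  rintro x ⟨l, hl, rfl⟩ ⟨l', hl', hl'eq⟩
  apply h
  simp only [smul_eq_mul] at hl'eq
  have : j⁻¹ * j' = l * l'⁻¹ := by
    calc j⁻¹ * j' = j⁻¹ * (j' * l') * l'⁻¹ := by group
      _ = j⁻¹ * (j * l) * l'⁻¹ := by rw [hl'eq]
      _ = l * l'⁻¹ := by group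
  rw [this]
  exact mul_inv_mem_levelTf W N hl hl'

end Diag

section Unit
variable {k : Type} [Field k] [NumberField k] (W : PlaneData k) [MeasurableSpace (GA W)] [BorelSpace (GA W)]
  (νf : Measure (torusFin W)) (νf' : Measure (torusFin' W)) (γ₀ : GA W) (DZf : Set (torusFin W))

/-- **(F-d) INSTANTIATED — THE UNIT'S LOWER BOUND**: for a finite set `J ⊆ Z_f` (inside `T_f`) of representatives of
distinct cosets of `T_f ∩ K(N)` whose translates of the level box lie in `DZ_f`,
`|J| · ν_f(levelTf N) · ν′_f(levelTf′ N) ≤ suppMeasure N γ₀`. -/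
theorem card_mul_measure_levelBox_le_suppMeasure [νf.IsHaarMeasure] [νf'.IsHaarMeasure] {N : ℕ} (hN : N ≠ 0)
    (J : Finset (torusFin W)) (hJZ : ∀ j ∈ J, j ∈ ZfIn W) (hJD : ∀ j ∈ J, j • levelTf W N ⊆ DZf)
    (hreps : ∀ j ∈ J, ∀ j' ∈ J, j ≠ j' → j⁻¹ * j' ∉ levelTf W N) :
    J.card * (νf (levelTf W N) * νf' (levelTf' W N)) ≤ suppMeasure W νf νf' γ₀ DZf N γ₀ := by
  haveI : BorelSpace (torusT W) := Subtype.borelSpace _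
  haveI : BorelSpace (torusFin W) := Subtype.borelSpace _
  haveI : BorelSpace (torusT' W) := Subtype.borelSpace _
  haveI : BorelSpace (torusFin' W) := Subtype.borelSpace _
  haveI : MeasurableConstSMul (torusFin W) (torusFin W) := ⟨fun c => measurable_const_mul c⟩
  haveI : MeasurableConstSMul (torusFin' W) (torusFin' W) := ⟨fun c => measurable_const_mul c⟩
  haveI : LocallyCompactSpace (torusFin' W) := locallyCompact_torusFin' W
  haveI : SecondCountableTopology (torusFin' W) := secondCountable_torusFin' W
  haveI : IsLocallyFiniteMeasure νf' := isLocallyFiniteMeasure_of_isFiniteMeasureOnCompacts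
  haveI : SigmaFinite νf' := sigmaFinite_of_locallyFinite
  -- the diagonal partners
  have hpart : ∀ j ∈ J, ∃ ζ : torusFin' W, ((ζ : torusT' W) : GA W) = ((j : torusT W) : GA W) ∧
      ((j : torusT W) : GA W) ∈ Subgroup.center (GA W) := fun j hj => exists_diag_of_mem_ZfIn W (hJZ j hj)
  choose! ζ hζ using hpart
  -- the boxes
  let E : torusFin W → Set (torusFin W × torusFin' W) := fun j => (j • levelTf W N) ×ˢ (ζ j • levelTf' W N)
  have hEmeas : ∀ j ∈ J, MeasurableSet (E j) := fun j _ =>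
    ((measurableSet_levelTf W hN).const_smul j).prod ((measurableSet_levelTf' W hN).const_smul (ζ j))
  have hEdisj : (J : Set (torusFin W)).PairwiseDisjoint E := by
    intro j hj j' hj' hne
    exact Set.disjoint_prod.2 (Or.inl (disjoint_smul_levelTf_of_inv_mul_notMem W N (hreps j hj j' hj' hne)))
  have hEsub : ∀ j ∈ J, E j ⊆ suppSet W γ₀ N γ₀ ∩ DZf ×ˢ Set.univ := by
    intro j hj p hp
    refine ⟨smul_levelTf_prod_subset_suppSet W γ₀ N (hζ j hj).1 (hζ j hj).2 hp, hJD j hj hp.1, Set.mem_univ _⟩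
  have hEmeasure : ∀ j ∈ J, (νf.prod νf') (E j) = νf (levelTf W N) * νf' (levelTf' W N) := by
    intro j _
    show (νf.prod νf') ((j • levelTf W N) ×ˢ (ζ j • levelTf' W N)) = _
    rw [Measure.prod_prod, measure_smul_set_eq νf j, measure_smul_set_eq νf' (ζ j)]
  calc (J.card : ℝ≥0∞) * (νf (levelTf W N) * νf' (levelTf' W N))
      = ∑ _j ∈ J, νf (levelTf W N) * νf' (levelTf' W N) := by rw [Finset.sum_const, nsmul_eq_mul]
    _ = ∑ j ∈ J, (νf.prod νf') (E j) := Finset.sum_congr rfl fun j hj => (hEmeasure j hj).symm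
    _ = (νf.prod νf') (⋃ j ∈ J, E j) := (measure_biUnion_finset hEdisj hEmeas).symm
    _ ≤ (νf.prod νf') (suppSet W γ₀ N γ₀ ∩ DZf ×ˢ Set.univ) := measure_mono (Set.iUnion₂_subset hEsub)
    _ = suppMeasure W νf νf' γ₀ DZf N γ₀ := rfl

end Unit

end Summit.Ventures.HodgeRepro.Tier4.Line4

end
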